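import Literature.AnabelianGeometry.AbsoluteAnabelian.FundamentalExtensionRestriction
import HarnessLib

/-!
# Restriction adapters, sequel: conjugate open subgroups and nested open subgroups

abc-iut cell, follow-ups (f1)/(f2) asked by abc-iut-L5-t4 (2026-08-26T03:10:04Z) on the adapters of
`FundamentalExtensionRestriction.lean` (writer abc-iut-w5-d053).  Pure profinite-group plumbing over
abc-iut-L4-t1's `FundamentalExtension` ([AbsTopIII] Thm 1.9, final paragraph, kurims p. 38: "open
injective homomorphisms of extensions of profinite groups"; the decomposition groups of [AbsTopIII]
Prop 1.4 / Thm 1.9 (a) are conjugacy classes of subgroups, so "isomorphs = conjugates"):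

* `innerIso E g : E ≅ E` — the inner automorphism of an extension by `g ∈ Π` (conjugation by `g` on
  `Π`, by `aug g` on `G`);
* (f1) `conjOpenSubgroup E g U` (`g U g⁻¹`, open) and the isomorphism
  `ofOpenSubgroupConjIso E g U : E.ofOpenSubgroup U ≅ E.ofOpenSubgroup (E.conjOpenSubgroup g U)` in the
  category of extensions, compatible with the inclusions and `innerIso` (`ofOpenSubgroupConjIso_hom_ι`);
* (f2) `ofOpenSubgroupMap E h : E.ofOpenSubgroup V ⟶ E.ofOpenSubgroup U` for `V ≤ U`, open injective
  (`isOpenInjective_ofOpenSubgroupMap`), with `ofOpenSubgroupMap_comp_ι` (transitivity of the inclusions).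

No `instance`, no notation; nothing here bears on the disputed [IUTchIII] Cor. 3.12; typed ≠ proved.
-/

open CategoryTheory Topology

universe u

namespace Literature.AnabelianGeometry.AbsoluteAnabelian

namespace FundamentalExtension

variable (E : FundamentalExtension.{u})

/-! ### Inner automorphisms of an extension -/

/-- Conjugation by `g` as a continuous homomorphism of a topological group. [folklore] -/
private noncomputable def conjHom {G : Type u} [Group G] [TopologicalSpace G] [IsTopologicalGroup G]
    (g : G) : G →ₜ* G :=
  { (MulAut.conj g).toMonoidHom with continuous_toFun := IsTopologicalGroup.continuous_conj g }

/-- **The inner automorphism of `E` by `g ∈ Π`**: conjugation by `g` on `Π` and by `aug g` on `G`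
(an isomorphism of extensions; "isomorphs = conjugates"). [cite: MochizukiAbsTopIII2015, Thm 1.9 p.38] -/
noncomputable def innerIso (g : E.arith) : E ≅ E where
  hom := ⟨conjHom g, conjHom (E.aug g), fun x => by
    change E.aug (g * x * g⁻¹) = E.aug g * E.aug x * (E.aug g)⁻¹
    rw [map_mul, map_mul, map_inv]⟩
  inv := ⟨conjHom g⁻¹, conjHom (E.aug g)⁻¹, fun x => by
    change E.aug (g⁻¹ * x * g⁻¹⁻¹) = (E.aug g)⁻¹ * E.aug x * (E.aug g)⁻¹⁻¹
    simp only [map_mul, map_inv]⟩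
  hom_inv_id := Hom.ext (ContinuousMonoidHom.ext fun x => by
      change g⁻¹ * (g * x * g⁻¹) * g⁻¹⁻¹ = x
      group)
    (ContinuousMonoidHom.ext fun x => by
      change (E.aug g)⁻¹ * (E.aug g * x * (E.aug g)⁻¹) * (E.aug g)⁻¹⁻¹ = x
      group)
  inv_hom_id := Hom.ext (ContinuousMonoidHom.ext fun x => by
      change g * (g⁻¹ * x * g⁻¹⁻¹) * g⁻¹ = x
      group)
    (ContinuousMonoidHom.ext fun x => by
      change E.aug g * ((E.aug g)⁻¹ * x * (E.aug g)⁻¹⁻¹) * (E.aug g)⁻¹ = x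
      group)

/-- The `Π`-component of `innerIso g` is conjugation by `g`. [cite: MochizukiAbsTopIII2015, Thm 1.9 p.38] -/
@[simp] theorem innerIso_hom_arith_apply (g x : E.arith) : (E.innerIso g).hom.arith x = g * x * g⁻¹ := rfl

/-- The `G`-component of `innerIso g` is conjugation by `aug g`. [cite: MochizukiAbsTopIII2015, Thm 1.9 p.38] -/
@[simp] theorem innerIso_hom_gal_apply (g : E.arith) (h : E.gal) :
    (E.innerIso g).hom.gal h = E.aug g * h * (E.aug g)⁻¹ := rfl

/-! ### (f1) Conjugate open subgroups give isomorphic restricted extensions -/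

section Conj

variable (g : E.arith) (U : OpenSubgroup E.arith)

/-- The conjugate open subgroup `g U g⁻¹`. [cite: MochizukiAbsTopIII2015, Thm 1.9 p.38] -/
noncomputable def conjOpenSubgroup : OpenSubgroup E.arith where
  toSubgroup := (U : Subgroup E.arith).map (MulAut.conj g).toMonoidHom
  isOpen' := by
    change IsOpen (((U : Subgroup E.arith).map (MulAut.conj g).toMonoidHom : Subgroup E.arith) :
      Set E.arith)
    rw [Subgroup.coe_map]
    exact ((Homeomorph.mulLeft g).trans (Homeomorph.mulRight g⁻¹)).isOpenMap _ U.isOpen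

/-- Membership in `g U g⁻¹`: `x ∈ g U g⁻¹ ↔ g⁻¹ x g ∈ U`. [cite: MochizukiAbsTopIII2015, Thm 1.9 p.38] -/
theorem mem_conjOpenSubgroup_iff {x : E.arith} :
    x ∈ (E.conjOpenSubgroup g U : Subgroup E.arith) ↔ g⁻¹ * x * g ∈ (U : Subgroup E.arith) := by
  change x ∈ (U : Subgroup E.arith).map (MulAut.conj g).toMonoidHom ↔ _
  constructor
  · rintro ⟨y, hy, rfl⟩
    have : g⁻¹ * (g * y * g⁻¹) * g = y := by group
    change g⁻¹ * (g * y * g⁻¹) * g ∈ _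
    rw [this]
    exact hy
  · intro hx
    refine ⟨g⁻¹ * x * g, hx, ?_⟩
    change g * (g⁻¹ * x * g) * g⁻¹ = x
    group

/-- `g u g⁻¹ ∈ g U g⁻¹` for `u ∈ U`. [cite: MochizukiAbsTopIII2015, Thm 1.9 p.38] -/
theorem conj_mem_conjOpenSubgroup {u : E.arith} (hu : u ∈ (U : Subgroup E.arith)) :
    g * u * g⁻¹ ∈ (E.conjOpenSubgroup g U : Subgroup E.arith) := by
  rw [mem_conjOpenSubgroup_iff]
  have : g⁻¹ * (g * u * g⁻¹) * g = u := by group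
  rw [this]
  exact hu

/-- `aug g · aug u · (aug g)⁻¹ ∈ aug(g U g⁻¹)` for `u ∈ U`. [cite: MochizukiAbsTopIII2015, Thm 1.9 p.38] -/
theorem conj_mem_augImage_conj {h : E.gal} (hh : h ∈ (E.augImage U).toSubgroup) :
    E.aug g * h * (E.aug g)⁻¹ ∈ (E.augImage (E.conjOpenSubgroup g U)).toSubgroup := by
  obtain ⟨u, hu, rfl⟩ := (E.mem_augImage_iff U).1 hh
  rw [mem_augImage_iff]
  refine ⟨g * u * g⁻¹, E.conj_mem_conjOpenSubgroup g U hu, ?_⟩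
  rw [map_mul, map_mul, map_inv]

/-- `(aug g)⁻¹ · k · aug g ∈ aug(U)` for `k ∈ aug(g U g⁻¹)`. [cite: MochizukiAbsTopIII2015, Thm 1.9 p.38] -/
theorem conj_inv_mem_augImage {k : E.gal} (hk : k ∈ (E.augImage (E.conjOpenSubgroup g U)).toSubgroup) :
    (E.aug g)⁻¹ * k * E.aug g ∈ (E.augImage U).toSubgroup := by
  obtain ⟨y, hy, rfl⟩ := (E.mem_augImage_iff _).1 hk
  rw [mem_augImage_iff]
  refine ⟨g⁻¹ * y * g, (E.mem_conjOpenSubgroup_iff g U).1 hy, ?_⟩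
  rw [map_mul, map_mul, map_inv]

/-- **(f1) Conjugate open subgroups give isomorphic restrictions**: conjugation by `g` induces
`E.ofOpenSubgroup U ≅ E.ofOpenSubgroup (g U g⁻¹)` in the category of extensions.
[cite: MochizukiAbsTopIII2015, Thm 1.9 p.38] -/
noncomputable def ofOpenSubgroupConjIso :
    E.ofOpenSubgroup U ≅ E.ofOpenSubgroup (E.conjOpenSubgroup g U) where
  hom :=
    { arith :=
        { toFun := fun x => ⟨g * x.1 * g⁻¹, E.conj_mem_conjOpenSubgroup g U x.2⟩
          map_one' := Subtype.ext (by change g * 1 * g⁻¹ = 1; group)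
          map_mul' := fun x y => Subtype.ext (by
            change g * (x.1 * y.1) * g⁻¹ = (g * x.1 * g⁻¹) * (g * y.1 * g⁻¹); group)
          continuous_toFun := ((IsTopologicalGroup.continuous_conj g).comp
            continuous_subtype_val).subtype_mk _ }
      gal :=
        { toFun := fun h => ⟨E.aug g * h.1 * (E.aug g)⁻¹, E.conj_mem_augImage_conj g U h.2⟩
          map_one' := Subtype.ext (by change E.aug g * 1 * (E.aug g)⁻¹ = 1; group)
          map_mul' := fun x y => Subtype.ext (by
            change E.aug g * (x.1 * y.1) * (E.aug g)⁻¹ =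
              (E.aug g * x.1 * (E.aug g)⁻¹) * (E.aug g * y.1 * (E.aug g)⁻¹); group)
          continuous_toFun := ((IsTopologicalGroup.continuous_conj (E.aug g)).comp
            continuous_subtype_val).subtype_mk _ }
      comm := fun x => Subtype.ext (by
        change E.aug (g * x.1 * g⁻¹) = E.aug g * E.aug x.1 * (E.aug g)⁻¹
        rw [map_mul, map_mul, map_inv]) }
  inv :=
    { arith :=
        { toFun := fun y => ⟨g⁻¹ * y.1 * g, (E.mem_conjOpenSubgroup_iff g U).1 y.2⟩
          map_one' := Subtype.ext (by change g⁻¹ * 1 * g = 1; group)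
          map_mul' := fun x y => Subtype.ext (by
            change g⁻¹ * (x.1 * y.1) * g = (g⁻¹ * x.1 * g) * (g⁻¹ * y.1 * g); group)
          continuous_toFun := by
            have hc : Continuous fun y : E.arith => g⁻¹ * y * g := by
              simpa using IsTopologicalGroup.continuous_conj g⁻¹
            exact (hc.comp continuous_subtype_val).subtype_mk _ }
      gal :=
        { toFun := fun k => ⟨(E.aug g)⁻¹ * k.1 * E.aug g, E.conj_inv_mem_augImage g U k.2⟩
          map_one' := Subtype.ext (by change (E.aug g)⁻¹ * 1 * E.aug g = 1; group)
          map_mul' := fun x y => Subtype.ext (by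
            change (E.aug g)⁻¹ * (x.1 * y.1) * E.aug g =
              ((E.aug g)⁻¹ * x.1 * E.aug g) * ((E.aug g)⁻¹ * y.1 * E.aug g); group)
          continuous_toFun := by
            have hc : Continuous fun k : E.gal => (E.aug g)⁻¹ * k * E.aug g := by
              simpa using IsTopologicalGroup.continuous_conj (E.aug g)⁻¹
            exact (hc.comp continuous_subtype_val).subtype_mk _ }
      comm := fun y => Subtype.ext (by
        change E.aug (g⁻¹ * y.1 * g) = (E.aug g)⁻¹ * E.aug y.1 * E.aug g
        rw [map_mul, map_mul, map_inv]) }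
  hom_inv_id := Hom.ext
    (ContinuousMonoidHom.ext fun x => Subtype.ext (by
      change g⁻¹ * (g * x.1 * g⁻¹) * g = x.1; group))
    (ContinuousMonoidHom.ext fun h => Subtype.ext (by
      change (E.aug g)⁻¹ * (E.aug g * h.1 * (E.aug g)⁻¹) * E.aug g = h.1; group))
  inv_hom_id := Hom.ext
    (ContinuousMonoidHom.ext fun y => Subtype.ext (by
      change g * (g⁻¹ * y.1 * g) * g⁻¹ = y.1; group))
    (ContinuousMonoidHom.ext fun k => Subtype.ext (by
      change E.aug g * ((E.aug g)⁻¹ * k.1 * E.aug g) * (E.aug g)⁻¹ = k.1; group))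

/-- The `Π`-component of the conjugation isomorphism. [cite: MochizukiAbsTopIII2015, Thm 1.9 p.38] -/
@[simp] theorem ofOpenSubgroupConjIso_hom_arith_apply_coe (x : (E.ofOpenSubgroup U).arith) :
    ((E.ofOpenSubgroupConjIso g U).hom.arith x).1 = g * x.1 * g⁻¹ := rfl

/-- **Compatibility with the inclusions**: conjugating inside `U` and then including equals including
and then applying the inner automorphism `innerIso g` of `E`. [cite: MochizukiAbsTopIII2015, Thm 1.9 p.38] -/
theorem ofOpenSubgroupConjIso_hom_ι :
    (E.ofOpenSubgroupConjIso g U).hom ≫ E.ofOpenSubgroupι (E.conjOpenSubgroup g U) =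
      E.ofOpenSubgroupι U ≫ (E.innerIso g).hom :=
  Hom.ext (ContinuousMonoidHom.ext fun _ => rfl) (ContinuousMonoidHom.ext fun _ => rfl)

end Conj

/-! ### (f2) Nested open subgroups -/

section Nested

/-- `aug(V) ⊆ aug(U)` for `V ≤ U`. [cite: MochizukiAbsTopIII2015, Thm 1.9 p.38] -/
theorem augImage_mono {V U : OpenSubgroup E.arith} (h : V ≤ U) :
    (E.augImage V).toSubgroup ≤ (E.augImage U).toSubgroup :=
  Subgroup.map_mono h

/-- **(f2) The inclusion `E.ofOpenSubgroup V ⟶ E.ofOpenSubgroup U`** for `V ≤ U`.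
[cite: MochizukiAbsTopIII2015, Thm 1.9 p.38] -/
noncomputable def ofOpenSubgroupMap {V U : OpenSubgroup E.arith} (h : V ≤ U) :
    E.ofOpenSubgroup V ⟶ E.ofOpenSubgroup U where
  arith := { Subgroup.inclusion (show (V : Subgroup E.arith) ≤ U from h) with
    continuous_toFun := continuous_inclusion (fun _ hx => h hx) }
  gal := { Subgroup.inclusion (E.augImage_mono h) with
    continuous_toFun := continuous_inclusion (fun _ hx => E.augImage_mono h hx) }
  comm := fun _ => rfl

/-- The `Π`-component of the nested inclusion. [cite: MochizukiAbsTopIII2015, Thm 1.9 p.38] -/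
@[simp] theorem ofOpenSubgroupMap_arith_apply_coe {V U : OpenSubgroup E.arith} (h : V ≤ U)
    (x : (E.ofOpenSubgroup V).arith) : ((E.ofOpenSubgroupMap h).arith x).1 = x.1 := rfl

/-- **Transitivity of the inclusions**: `(V ↪ U) ≫ (U ↪ Π) = (V ↪ Π)`.
[cite: MochizukiAbsTopIII2015, Thm 1.9 p.38] -/
theorem ofOpenSubgroupMap_comp_ι {V U : OpenSubgroup E.arith} (h : V ≤ U) :
    E.ofOpenSubgroupMap h ≫ E.ofOpenSubgroupι U = E.ofOpenSubgroupι V :=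
  Hom.ext (ContinuousMonoidHom.ext fun _ => rfl) (ContinuousMonoidHom.ext fun _ => rfl)

/-- **(f2) The nested inclusion is open injective.** [cite: MochizukiAbsTopIII2015, Thm 1.9 p.38] -/
theorem isOpenInjective_ofOpenSubgroupMap {V U : OpenSubgroup E.arith} (h : V ≤ U) :
    Hom.IsOpenInjective (E.ofOpenSubgroupMap h) where
  arith_injective := fun x y hxy => Subtype.ext (by
    have h1 := congrArg (fun z : (E.ofOpenSubgroup U).arith => z.1) hxy
    exact h1)
  isOpen_range_arith := by
    have hr : Set.range (E.ofOpenSubgroupMap h).arith =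
        Subtype.val ⁻¹' ((V : Subgroup E.arith) : Set E.arith) := by
      ext x
      constructor
      · rintro ⟨y, rfl⟩
        exact y.2
      · intro hx
        exact ⟨⟨x.1, hx⟩, rfl⟩
    rw [hr]
    exact V.isOpen.preimage continuous_subtype_val
  gal_injective := fun x y hxy => Subtype.ext (by
    have h1 := congrArg (fun z : (E.ofOpenSubgroup U).gal => z.1) hxy
    exact h1)
  isOpen_range_gal := by
    have hr : Set.range (E.ofOpenSubgroupMap h).gal =
        Subtype.val ⁻¹' ((E.augImage V).toSubgroup : Set E.gal) := by
      ext x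
      constructor
      · rintro ⟨y, rfl⟩
        exact y.2
      · intro hx
        exact ⟨⟨x.1, hx⟩, rfl⟩
    rw [hr]
    exact (E.isOpen_augImage V).preimage continuous_subtype_val

/-- The composite `Δ_V → Δ_U → Δ` bookkeeping: `Δ_V = Δ ∩ V ≤ Δ ∩ U`. [cite: MochizukiAbsTopIII2015, Thm 1.9 p.38] -/
theorem map_geom_ofOpenSubgroup_mono {V U : OpenSubgroup E.arith} (h : V ≤ U) :
    (E.ofOpenSubgroup V).geom.map (E.ofOpenSubgroupι V).arith.toMonoidHom ≤
      (E.ofOpenSubgroup U).geom.map (E.ofOpenSubgroupι U).arith.toMonoidHom := by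
  rw [map_geom_ofOpenSubgroup, map_geom_ofOpenSubgroup]
  exact inf_le_inf_left _ h

end Nested

end FundamentalExtension

end Literature.AnabelianGeometry.AbsoluteAnabelian
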